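import Mathlib
import HarnessLib
import Summits.ValiantsHypothesis.ValiantsHypothesis.Theorems.SchenstedIndexPencilPolarisation

/-!
# Route SchenstedIndex — relabelling slots: permutations of `S` act on block partitions, and the
# polarisation step "label-consistent vanishing ⇒ vanishing on all slot pencils"

Successor step (e) of the blueprint for `BorderPcPerThree` AS TYPED (evidence note on
stmt-ValiantsHypothesis-16085).  For a permutation `g` of the slot set `S` and an `m`-block partition
`π` of `S`, `g • π` is the partition into the blocks `g(B)` (`mapPerm`, via Mathlib's
`Finpartition.map` along the order isomorphism `Finset.map g` of `Finset S`); the block-cycle sums of a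
slot pencil transform by `E'(N ∘ g)(π) = E'(N)(g • π)` (`sum_blockCycleVec_comp_perm`).  Consequently
(`sum_blockCycleVec_eq_zero_of_labelConsistent`): if a functional `a` on the `m`-block partitions of
`S = Fin t × L` is invariant under the LABEL-PRESERVING slot permutations and annihilates the
block-cycle sums of every LABEL-CONSISTENT pencil (`N_s` depending only on the label `s.2`), then it
annihilates the block-cycle sums of EVERY slot pencil — by the multilinear expansion
`sum_blockCycleVec_pencil_sum` at `M_ℓ = ∑_k λ_(k,ℓ) N_(k,ℓ)` and the square-free coefficient
`sum_filter_bijective_eq_zero_of_forall_eval`.  Route-independent file.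

HONEST FRAMING: bookkeeping for an OPEN crux; nothing here bears on `VP ≠ VNP`.
-/

set_option linter.dupNamespace false

noncomputable section

namespace Summit.ValiantsHypothesis.ValiantsHypothesis.Theorems.SchenstedIndex

open Matrix
open Literature.Computability.AlgebraicComplexity

/-! ## Permutations of the slots act on block partitions -/

/-- `Finset.map` along a permutation, as an order isomorphism of `Finset S`. -/
def finsetMapOrderIso {S : Type*} (g : Equiv.Perm S) : Finset S ≃o Finset S where
  toEquiv := g.finsetCongr
  map_rel_iff' := by
    intro A B
    exact Finset.map_subset_map

/-- The image `g • π` of a partition of `univ` under a permutation `g` of the ground type: blocks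
`g(B)`. -/
def mapPerm {S : Type*} [Fintype S] [DecidableEq S] (g : Equiv.Perm S)
    (π : Finpartition (Finset.univ : Finset S)) : Finpartition (Finset.univ : Finset S) :=
  (π.map (finsetMapOrderIso g)).copy (by
    change Finset.univ.map g.toEmbedding = Finset.univ
    exact Finset.map_univ_equiv g)

/-- The parts of `g • π` are the images of the parts of `π`. -/
theorem mapPerm_parts {S : Type*} [Fintype S] [DecidableEq S] (g : Equiv.Perm S)
    (π : Finpartition (Finset.univ : Finset S)) :
    (mapPerm g π).parts = π.parts.map (g.finsetCongr).toEmbedding := rfl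

/-- Membership in the parts of `g • π`. -/
theorem mem_mapPerm_parts {S : Type*} [Fintype S] [DecidableEq S] (g : Equiv.Perm S)
    (π : Finpartition (Finset.univ : Finset S)) (B : Finset S) :
    B ∈ (mapPerm g π).parts ↔ ∃ A ∈ π.parts, A.map g.toEmbedding = B := by
  rw [mapPerm_parts, Finset.mem_map]
  rfl

/-- `g • π` has blocks of size `m` if `π` does. -/
theorem card_of_mem_mapPerm_parts {S : Type*} [Fintype S] [DecidableEq S] (g : Equiv.Perm S)
    {π : Finpartition (Finset.univ : Finset S)} {m : ℕ} (hπ : ∀ B ∈ π.parts, B.card = m)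
    (B : Finset S) (hB : B ∈ (mapPerm g π).parts) : B.card = m := by
  obtain ⟨A, hA, rfl⟩ := (mem_mapPerm_parts g π B).1 hB
  rw [Finset.card_map, hπ A hA]

/-- `mapPerm` is an action: `g⁻¹ • (g • π) = π`. -/
theorem mapPerm_symm_mapPerm {S : Type*} [Fintype S] [DecidableEq S] (g : Equiv.Perm S)
    (π : Finpartition (Finset.univ : Finset S)) : mapPerm g.symm (mapPerm g π) = π := by
  apply Finpartition.ext
  rw [mapPerm_parts, mapPerm_parts, Finset.map_map]
  convert Finset.map_refl (s := π.parts) using 2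
  ext A s
  simp [Equiv.finsetCongr_apply]

/-- `mapPerm` on the subtype of `m`-block partitions. -/
def mapPermSub {S : Type*} [Fintype S] [DecidableEq S] {m : ℕ} (g : Equiv.Perm S)
    (π : {π : Finpartition (Finset.univ : Finset S) // ∀ B ∈ π.parts, B.card = m}) :
    {π : Finpartition (Finset.univ : Finset S) // ∀ B ∈ π.parts, B.card = m} :=
  ⟨mapPerm g π.1, fun B hB => card_of_mem_mapPerm_parts g π.2 B hB⟩

/-- `π ↦ g • π` is a bijection of the `m`-block partitions (inverse `g⁻¹ • ·`). -/
def mapPermEquiv {S : Type*} [Fintype S] [DecidableEq S] {m : ℕ} (g : Equiv.Perm S) :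
    {π : Finpartition (Finset.univ : Finset S) // ∀ B ∈ π.parts, B.card = m} ≃
    {π : Finpartition (Finset.univ : Finset S) // ∀ B ∈ π.parts, B.card = m} where
  toFun := mapPermSub g
  invFun := mapPermSub g.symm
  left_inv π := Subtype.ext (mapPerm_symm_mapPerm g π.1)
  right_inv π := Subtype.ext (by
    have h := mapPerm_symm_mapPerm g.symm π.1
    rw [Equiv.symm_symm] at h
    exact h)

/-! ## Block-cycle sums under relabelling -/

/-- The block term is transported along `g`: for a block `A`,
`∑_(q : Fin m ≃ A) ∏_i N_(g (q i)) (ρ (g (q i))) (ρ (g (q (i+1)))) =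
 ∑_(q' : Fin m ≃ g(A)) ∏_i N_(q' i) (ρ (q' i)) (ρ (q' (i+1)))`. -/
theorem blockCycle_comp_perm {S : Type*} [Fintype S] [DecidableEq S] {m n : ℕ} {R : Type*}
    [CommRing R] (g : Equiv.Perm S) (F : S → Fin n → Fin n → R) (ρ : S → Fin n) (A : Finset S) :
    (∑ q : Fin m ≃ ↥A, ∏ i : Fin m, F (g (q i).1) (ρ (g (q i).1)) (ρ (g (q (finRotate m i)).1))) =
      ∑ q : Fin m ≃ ↥(A.map g.toEmbedding), ∏ i : Fin m,
        F (q i).1 (ρ (q i).1) (ρ (q (finRotate m i)).1) := by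
  -- the bijection `A ≃ g(A)` induced by `g`
  let e : ↥A ≃ ↥(A.map g.toEmbedding) :=
    { toFun := fun s => ⟨g s.1, Finset.mem_map_of_mem _ s.2⟩
      invFun := fun s => ⟨g.symm s.1, by
        obtain ⟨x, hx, hxs⟩ := Finset.mem_map.1 s.2
        have : g.symm s.1 = x := by rw [← hxs]; exact g.symm_apply_apply x
        rw [this]; exact hx⟩
      left_inv := fun s => Subtype.ext (g.symm_apply_apply s.1)
      right_inv := fun s => Subtype.ext (g.apply_symm_apply s.1) }
  rw [← (Equiv.equivCongr (Equiv.refl (Fin m)) e).sum_comp]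
  rfl

/-- **Block-cycle sums transform under relabelling**: `E'(N ∘ g)(π) = E'(N)(g • π)`, where
`E'(N)(π) = ∑_ρ ∏_(B ∈ π) ∑_q ∏_i (N_(q i))_(ρ (q i), ρ (q (i+1)))`. -/
theorem sum_blockCycleVec_comp_perm {S : Type*} [Fintype S] [DecidableEq S] {m n : ℕ}
    (g : Equiv.Perm S) (N : S → Matrix (Fin n) (Fin n) ℂ)
    (π : Finpartition (Finset.univ : Finset S)) :
    (∑ ρ : S → Fin n, ∏ B ∈ π.parts, ∑ q : Fin m ≃ ↥B, ∏ i : Fin m,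
        N (g (q i).1) (ρ (q i).1) (ρ (q (finRotate m i)).1)) =
      ∑ ρ : S → Fin n, ∏ B ∈ (mapPerm g π).parts, ∑ q : Fin m ≃ ↥B, ∏ i : Fin m,
        N (q i).1 (ρ (q i).1) (ρ (q (finRotate m i)).1) := by
  classical
  -- reindex the colourings by `ρ ↦ ρ ∘ g⁻¹`
  rw [← (g.symm.arrowCongr (Equiv.refl (Fin n))).sum_comp]
  refine Finset.sum_congr rfl fun ρ _ => ?_
  rw [mapPerm_parts, Finset.prod_map]
  refine Finset.prod_congr rfl fun A _ => ?_
  simp only [Equiv.arrowCongr_apply, Equiv.coe_refl, Function.comp_apply, Equiv.symm_symm, id_eq]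
  exact blockCycle_comp_perm (m := m) g (fun s a b => N s a b) ρ A

/-! ## Polarisation: label-consistent vanishing suffices -/

/-- **Label-consistent vanishing ⇒ vanishing on all slot pencils.** Let `S = Fin t × L` (slot `(k, ℓ)`
has label `ℓ`) and let `a` be a functional on the `m`-block partitions of `S` that is invariant under
every LABEL-PRESERVING permutation of the slots.  If `a` annihilates the block-cycle sums of every
label-consistent pencil `s ↦ M_(s.2)`, then it annihilates those of every slot pencil `N : S → M_n(ℂ)`. -/
theorem sum_blockCycleVec_eq_zero_of_labelConsistent {t m n : ℕ} {L : Type*} [Fintype L]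
    [DecidableEq L]
    (a : {π : Finpartition (Finset.univ : Finset (Fin t × L)) // ∀ B ∈ π.parts, B.card = m} → ℂ)
    (ha : ∀ (g : Equiv.Perm (Fin t × L)), (∀ s, (g s).2 = s.2) → ∀ π, a (mapPermSub g π) = a π)
    (hvan : ∀ M : L → Matrix (Fin n) (Fin n) ℂ,
      ∑ π : {π : Finpartition (Finset.univ : Finset (Fin t × L)) // ∀ B ∈ π.parts, B.card = m},
        a π * ∑ ρ : Fin t × L → Fin n, ∏ B ∈ π.1.parts, ∑ q : Fin m ≃ ↥B, ∏ i : Fin m,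
          M (q i).1.2 (ρ (q i).1) (ρ (q (finRotate m i)).1) = 0)
    (N : Fin t × L → Matrix (Fin n) (Fin n) ℂ) :
    ∑ π : {π : Finpartition (Finset.univ : Finset (Fin t × L)) // ∀ B ∈ π.parts, B.card = m},
      a π * ∑ ρ : Fin t × L → Fin n, ∏ B ∈ π.1.parts, ∑ q : Fin m ≃ ↥B, ∏ i : Fin m,
        N (q i).1 (ρ (q i).1) (ρ (q (finRotate m i)).1) = 0 := by
  classical
  -- `c φ` := the functional applied to the pencil `N^φ_s = N_(φ s, s.2)`
  set c : (Fin t × L → Fin t) → ℂ := fun φ =>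
    ∑ π : {π : Finpartition (Finset.univ : Finset (Fin t × L)) // ∀ B ∈ π.parts, B.card = m},
      a π * ∑ ρ : Fin t × L → Fin n, ∏ B ∈ π.1.parts, ∑ q : Fin m ≃ ↥B, ∏ i : Fin m,
        N (φ (q i).1, (q i).1.2) (ρ (q i).1) (ρ (q (finRotate m i)).1) with hc
  -- the polynomial identity from the label-consistent pencils `M^λ_ℓ = ∑_k λ_(k,ℓ) N_(k,ℓ)`
  have hpoly : ∀ lam : Fin t × L → ℂ, ∑ φ : Fin t × L → Fin t, (∏ s, lam (φ s, s.2)) * c φ = 0 := by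
    intro lam
    have h := hvan (fun ℓ => ∑ k : Fin t, lam (k, ℓ) • N (k, ℓ))
    have hexp : ∀ π : {π : Finpartition (Finset.univ : Finset (Fin t × L)) //
        ∀ B ∈ π.parts, B.card = m},
        (∑ ρ : Fin t × L → Fin n, ∏ B ∈ π.1.parts, ∑ q : Fin m ≃ ↥B, ∏ i : Fin m,
          (fun ℓ => ∑ k : Fin t, lam (k, ℓ) • N (k, ℓ)) (q i).1.2 (ρ (q i).1)
            (ρ (q (finRotate m i)).1)) =
        ∑ φ : Fin t × L → Fin t, (∏ s, lam (φ s, s.2)) *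
          ∑ ρ : Fin t × L → Fin n, ∏ B ∈ π.1.parts, ∑ q : Fin m ≃ ↥B, ∏ i : Fin m,
            N (φ (q i).1, (q i).1.2) (ρ (q i).1) (ρ (q (finRotate m i)).1) := fun π =>
      sum_blockCycleVec_pencil_sum π.1 (fun s k => N (k, s.2)) (fun s k => lam (k, s.2))
    simp_rw [hexp, Finset.mul_sum] at h
    rw [Finset.sum_comm] at h
    rw [← h]
    refine Finset.sum_congr rfl fun φ _ => ?_
    rw [hc]
    beta_reduce
    rw [Finset.mul_sum]
    refine Finset.sum_congr rfl fun π _ => ?_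
    rw [Finset.mul_sum, Finset.mul_sum]
    refine Finset.sum_congr rfl fun ρ _ => ?_
    ring
  -- the square-free coefficient: the sum over the label-preserving slot permutations vanishes
  have hbij := sum_filter_bijective_eq_zero_of_forall_eval c hpoly
  -- every such term equals the target quantity (invariance of `a`)
  have hconst : ∀ φ ∈ (Finset.univ : Finset (Fin t × L → Fin t)).filter
      (fun φ => Function.Bijective (fun s : Fin t × L => (φ s, s.2))),
      c φ = ∑ π : {π : Finpartition (Finset.univ : Finset (Fin t × L)) // ∀ B ∈ π.parts, B.card = m},
        a π * ∑ ρ : Fin t × L → Fin n, ∏ B ∈ π.1.parts, ∑ q : Fin m ≃ ↥B, ∏ i : Fin m,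
          N (q i).1 (ρ (q i).1) (ρ (q (finRotate m i)).1) := by
    intro φ hφ
    obtain ⟨-, hφ⟩ := Finset.mem_filter.1 hφ
    set g : Equiv.Perm (Fin t × L) := Equiv.ofBijective _ hφ with hg
    have hg2 : ∀ s, (g s).2 = s.2 := fun s => rfl
    rw [hc]
    -- `N^φ = N ∘ g`, transport the block-cycle sums to `g • π`, and reindex `π`
    have hstep : ∀ π : {π : Finpartition (Finset.univ : Finset (Fin t × L)) //
        ∀ B ∈ π.parts, B.card = m},
        (∑ ρ : Fin t × L → Fin n, ∏ B ∈ π.1.parts, ∑ q : Fin m ≃ ↥B, ∏ i : Fin m,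
          N (φ (q i).1, (q i).1.2) (ρ (q i).1) (ρ (q (finRotate m i)).1)) =
        ∑ ρ : Fin t × L → Fin n, ∏ B ∈ (mapPermSub g π).1.parts, ∑ q : Fin m ≃ ↥B, ∏ i : Fin m,
          N (q i).1 (ρ (q i).1) (ρ (q (finRotate m i)).1) := fun π =>
      sum_blockCycleVec_comp_perm g N π.1
    simp_rw [hstep]
    conv_rhs => rw [← (mapPermEquiv (m := m) g).sum_comp]
    refine Finset.sum_congr rfl fun π _ => ?_
    rw [show (mapPermEquiv (m := m) g) π = mapPermSub g π from rfl, ha g hg2 π]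
  rw [Finset.sum_congr rfl hconst, Finset.sum_const, nsmul_eq_mul] at hbij
  have hne : ((Finset.univ : Finset (Fin t × L → Fin t)).filter
      (fun φ => Function.Bijective (fun s : Fin t × L => (φ s, s.2)))).card ≠ 0 := by
    rw [Finset.card_ne_zero]
    exact ⟨fun s => s.1, Finset.mem_filter.2 ⟨Finset.mem_univ _,
      ⟨fun a b h => by simpa [Prod.ext_iff] using h, fun s => ⟨s, rfl⟩⟩⟩⟩
  exact (mul_eq_zero.1 hbij).resolve_left (Nat.cast_ne_zero.2 hne)

end Summit.ValiantsHypothesis.ValiantsHypothesis.Theorems.SchenstedIndex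

end
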